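import Summits.QuantumFields.BalabanUV.Beta.D1BFx.NeedleGhostBubbleRow
import Summits.QuantumFields.BalabanUV.Beta.D1BFx.GhostLegBlockMass

/-!
# `BalabanUV.Beta.D1BFx.NeedleGhostBubbleRowClosed` — road «BF-x» for binder row D1, slot (K), END row `hGrp gN` (NEEDLES ∪ G_R), (N-2) rows
# «NT-4» ∕ «NT-5» FILE C: THE BLOCK-MASS LETTER OF FILE B DISCHARGED BY M10 (`GhostLegBlockMass.sum_B_abs_Ggh_le`, n-free `cNear a`, `ghDelta a`) —
# `h₄` and `h₅` of `NeedleRowGlue.abs_gN_row_le_of_tables` modulo ONE displayed UNITS line `|ωgh n·cK n·cQ n| ≤ k·n⁶`, constants explicit and n-FREE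

HONEST DEPENDENCY (cell records, verbatim): «continuum YM on T⁴ ⇐ BetaPertH ∧ nine spine estimates (0/9 proved); BetaPertH ⇐ (D1) ∧ (D4) ∧
CAP+tail; G-an2-4 gates asym, D1 and NE2/3/4.»  HONEST FRAMING (cell contract, verbatim): «discharging `BetaPertH` makes Bałaban's UV stability
UNCONDITIONAL — a real constructive-QFT result; it is NOT the continuum limit and NOT the Clay problem.»  THIS MODULE DISCHARGES NOTHING of the wall:
it is [folklore] composition BY NAME — FILE B's `NeedleGhostBubbleRow.h₄_of_blockMass_scaling` ∕ `h₅_of_blockMass_scaling` at `(CG n, δG) :=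
(cNear a, ghDelta a)` with the letter `hM` fed by `GhostLegBlockMass.sum_B_abs_Ggh_le` (an3-g57's corollary of the hypothesis-free `GhostLegFree.ghost_d0`,
p214847; couriered p257692).  No `def`, no `def … : Prop`, nothing cited, 0 sorry.  THE ONLY DISPLAYED LETTER LEFT is the scalar UNITS inequality
`|ωgh n·(cK n·cQ n)| ≤ k·n⁶` (slot (K)'s pinning — ruled NOWHERE in this file; at the owner's ray of record `(cK, cQ, x₀) = (c·n², c·a, −c)`,
`ωgh·cK² = −4N²n⁸` it reads `4N²a·n⁶ ≤ k·n⁶`: met with `k = 4N²a`, owner FINDING U-1 ∕ ruling ρ-g9-29 P9–P10).  Asserts nothing of Bałaban's.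
Root-level binders hW ∕ hR-sockets ∕ hSX-socket ∕ D1Tel ∕ D1Rep — 0 discharged; (K) NOT closed; NOT D1, NOT `BetaPertH`, NOT continuum, NOT Clay.

ABSOLUTE RULE (cell charter, verbatim): «No internally-minted statement may enter as a cited fact. Every hypothesis is either kernel-proved in this
package or a verbatim quotation of a PUBLISHED theorem with page reference. The manuscript(s) under audit are NOT citable for their own disputed
steps — they are the thing under adjudication; programme-internal (2001/route/tribunal) claims are never citable.»

WHY (owner d1-p2-g9 ruling ρ-g9-28 (d) «T4∕T5 … first refusal gan24-leaf-05 lineage»; FINDING U-1 l.29373 «GO NT-4∕NT-5»; ruling ρ-g9-30 l.29421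
«M10 IS IN THE TREE's CONE — COURIER ORDER … ⇒ T₄∕T₅ close with tolerance MET at the ray (`4N²a·cNear(a)² ≤ k`)»).

CONTENT ([folklore]): **`h₄_of_scaling`**, **`h₅_of_scaling`** — `(ha : 0 < a) (hk : ∀ n ≥ 2, |ωgh n * (cK n * cQ n)| ≤ k * n^6)` (resp. `cQ n * cK n`)
⊢ `h₄` ∕ `h₅` VERBATIM with `C₄ = C₅ := k * cNear a ^ 2 * (2 * ((1 + 4 ∕ ghDelta a)^2 * latticeConst 4 (ghDelta a ∕ 2)))`.
Unit `b2b-balaban-gan24-formalise-leaf-05` (gen 41), G-an2-4 swarm leaf prover on cross-lane kernel duty; `LEAVES-BFx.md` row (N) ∕ (N-2) «NT-4»∕«NT-5» FILE C.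
-/

noncomputable section

namespace Summit.QuantumFields.BalabanUV.Beta.D1BFx.NeedleGhostBubbleRowClosed

open Finset
open scoped BigOperators
open Literature.MathematicalPhysics.QuantumFieldTheory.Balaban1983to89
open Literature.MathematicalPhysics.QuantumFieldTheory.Balaban1983to89.Beta
open B4Sect5Proof (latticeConst latticeConst_nonneg)
open ExpKernelCalculus (Site)
open DyadicShell (Pt toReal)
open WindowIdentification (fullSum)
open DressedMomentNormalisation (resSite)
open GhostStencil (ghCur)
open Summit.QuantumFields.BalabanUV.Beta.D1BFx.FineHessianSectors (biBubbleTable)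
open Summit.QuantumFields.BalabanUV.Beta.D1BFx.GhostStencilRooted (qAntiAt)
open Summit.QuantumFields.BalabanUV.Beta.D1BFx.GhostStencilRootedReflection (ctrHalf)
open Summit.QuantumFields.BalabanUV.Beta.D1BFx.GhostLeg (Ggh)
open Summit.QuantumFields.BalabanUV.Beta.D1BFx.GhostLegFree (ghDelta ghDelta_pos)
open Summit.QuantumFields.BalabanUV.Beta.D1BFx.GhostLegBlockMass (cNear sum_B_abs_Ggh_le)
open Summit.QuantumFields.BalabanUV.Beta.D1BFx.NeedleGhostBubbleRow (h₄_of_blockMass_scaling h₅_of_blockMass_scaling)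

variable {a : ℝ} {ωgh cK cQ : ℕ → ℝ} {k : ℝ}

/-- [folklore] **«NT-4» CLOSED MODULO THE UNITS LINE**: `(ha : 0 < a) (hk : ∀ n ≥ 2, |ωgh n·(cK n·cQ n)| ≤ k·n⁶)` ⊢ the row `h₄` (`ghCur ⊗ qA` over `Ggh`) of
`NeedleRowGlue.abs_gN_row_le_of_tables` VERBATIM, with the explicit n-FREE constant `C₄ := k·cNear(a)²·(2·((1 + 4∕ghDelta a)²·latticeConst 4 (ghDelta a∕2)))`
(FILE B at `(CG n, δG) := (cNear a, ghDelta a)`, the block-mass letter fed by M10 `GhostLegBlockMass.sum_B_abs_Ggh_le`). -/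
theorem h₄_of_scaling (ha : 0 < a) (hk : ∀ n : ℕ, 2 ≤ n → |ωgh n * (cK n * cQ n)| ≤ k * (n : ℝ) ^ 6) (μ ν : Fin 4) :
    ∀ n : ℕ, 2 ≤ n → ∀ [NeZero n], |ωgh n * (cK n * cQ n) * ∑ b ∈ (univ : Finset (Fin 4 → Fin n)).image resSite, ((n : ℝ) ^ 4)⁻¹ *
      (((n : ℝ) ^ 8)⁻¹ * fullSum (fun w : Pt => toReal w μ * toReal w ν *
        biBubbleTable (Ggh n a) (Ggh n a) ghCur (qAntiAt (ctrHalf n) n) μ ν (b + w) b))|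
        ≤ k * cNear a ^ 2 * (2 * ((1 + 4 / ghDelta a) ^ 2 * latticeConst 4 (ghDelta a / 2))) := by
  have hk' : ∀ n : ℕ, 2 ≤ n → |ωgh n * (cK n * cQ n)| * ((fun _ : ℕ => cNear a) n) ^ 2 ≤ (k * cNear a ^ 2) * (n : ℝ) ^ 6 := by
    intro n hn
    have h := mul_le_mul_of_nonneg_right (hk n hn) (sq_nonneg (cNear a))
    calc |ωgh n * (cK n * cQ n)| * ((fun _ : ℕ => cNear a) n) ^ 2 = |ωgh n * (cK n * cQ n)| * cNear a ^ 2 := rfl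
      _ ≤ k * (n : ℝ) ^ 6 * cNear a ^ 2 := h
      _ = (k * cNear a ^ 2) * (n : ℝ) ^ 6 := by ring
  exact h₄_of_blockMass_scaling (CG := fun _ : ℕ => cNear a) ha (ghDelta_pos ha) (fun n _ y β => sum_B_abs_Ggh_le n ha y β) hk' μ ν

/-- [folklore] **«NT-5» CLOSED MODULO THE UNITS LINE**: `(ha : 0 < a) (hk : ∀ n ≥ 2, |ωgh n·(cQ n·cK n)| ≤ k·n⁶)` ⊢ the row `h₅` (`qA ⊗ ghCur` over `Ggh`) of
`NeedleRowGlue.abs_gN_row_le_of_tables` VERBATIM, with `C₅ := k·cNear(a)²·(2·((1 + 4∕ghDelta a)²·latticeConst 4 (ghDelta a∕2)))`. -/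
theorem h₅_of_scaling (ha : 0 < a) (hk : ∀ n : ℕ, 2 ≤ n → |ωgh n * (cQ n * cK n)| ≤ k * (n : ℝ) ^ 6) (μ ν : Fin 4) :
    ∀ n : ℕ, 2 ≤ n → ∀ [NeZero n], |ωgh n * (cQ n * cK n) * ∑ b ∈ (univ : Finset (Fin 4 → Fin n)).image resSite, ((n : ℝ) ^ 4)⁻¹ *
      (((n : ℝ) ^ 8)⁻¹ * fullSum (fun w : Pt => toReal w μ * toReal w ν *
        biBubbleTable (Ggh n a) (Ggh n a) (qAntiAt (ctrHalf n) n) ghCur μ ν (b + w) b))|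
        ≤ k * cNear a ^ 2 * (2 * ((1 + 4 / ghDelta a) ^ 2 * latticeConst 4 (ghDelta a / 2))) := by
  have hk' : ∀ n : ℕ, 2 ≤ n → |ωgh n * (cQ n * cK n)| * ((fun _ : ℕ => cNear a) n) ^ 2 ≤ (k * cNear a ^ 2) * (n : ℝ) ^ 6 := by
    intro n hn
    have h := mul_le_mul_of_nonneg_right (hk n hn) (sq_nonneg (cNear a))
    calc |ωgh n * (cQ n * cK n)| * ((fun _ : ℕ => cNear a) n) ^ 2 = |ωgh n * (cQ n * cK n)| * cNear a ^ 2 := rfl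
      _ ≤ k * (n : ℝ) ^ 6 * cNear a ^ 2 := h
      _ = (k * cNear a ^ 2) * (n : ℝ) ^ 6 := by ring
  exact h₅_of_blockMass_scaling (CG := fun _ : ℕ => cNear a) ha (ghDelta_pos ha) (fun n _ y β => sum_B_abs_Ggh_le n ha y β) hk' μ ν

end Summit.QuantumFields.BalabanUV.Beta.D1BFx.NeedleGhostBubbleRowClosed

end
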